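import Mathlib.NumberTheory.Divisors
import Mathlib.Analysis.Normed.Field.Basic
import Mathlib.Algebra.Order.BigOperators.Ring.Finset
import Mathlib.Analysis.SpecialFunctions.Pow.Real
import HarnessLib

/-!
# Route `PrimeLevelFamEdge`, crux K_A `MomentsBeyondDiagonal` (stmt-Parity-20007), line «petersson_layers» v4:
# the `ℓ²` NORM OF PRODUCT-INDEXED (Dirichlet-convolution) COEFFICIENTS

In the balanced regrouping of a Petersson layer (`…LayersHeckeReindex`, `…LayersKloostermanProduct`,
`…LayersBesselSeparation`) the bilinear coefficients are Dirichlet convolutions: `α_u = Σ_{m₁'m₂' = u} f(m₁') g(m₂')`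
(mollifier side, `u ≤ q̂^{2Δ'}`) and `β_v = Σ_{n₁'n₂' = v} f'(n₁') g'(n₂')` (AFE side).  Every bilinear Kloosterman bound
— the completion bound `…LayersFourierBound`, Pascadi's Thm 7.1 `pascadi2025_theorem71` — is in `‖α‖₂ ‖β‖₂`; this file
bounds these norms by the factors' norms and a divisor bound (Cauchy–Schwarz along the divisors of `u`):

  `Σ_{u ≤ XY} ‖Σ_{x ≤ X, y ≤ Y, xy = u} f(x) g(y)‖² ≤ D · (Σ_{x ≤ X} ‖f x‖²) · (Σ_{y ≤ Y} ‖g y‖²)`   whenever `τ(u) ≤ D` on `[1, XY]`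

(`norm_sq_convolution_sum_le`), with the pointwise step `‖Σ_{xy=u} f(x)g(y)‖² ≤ τ(u) Σ_{xy=u} ‖f x‖²‖g y‖²`
(`norm_sq_convolution_le`).  With the tree's divisor bound `τ(u) ≤ C_ε u^ε` this is `‖f ∗ g‖₂ ≤ √(C_ε) (XY)^{ε/2} ‖f‖₂ ‖g‖₂`.
Proof only (def-free helper toward `stub_farP` / `stub_band`); nothing about any layer, K_A or Landau–Siegel zeros is claimed.
-/

noncomputable section

open Finset

namespace Summit.Parity.GeneralizedHardyLittlewood.Theorems.MomentsBeyondDiagonal.Layers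

/-- The representations of `u` as a product `x·y` with `x ≤ X`, `y ≤ Y` (a subset of `{(d, u/d) : d ∣ u}`). [folklore] -/
theorem card_filter_mul_eq_le_card_divisors (X Y : ℕ) {u : ℕ} (hu : u ≠ 0) :
    #((Icc 1 X ×ˢ Icc 1 Y).filter (fun p : ℕ × ℕ ↦ p.1 * p.2 = u)) ≤ #u.divisors := by
  refine Finset.card_le_card_of_injOn (fun p ↦ p.1) (fun p hp ↦ ?_) (fun p hp p' hp' h ↦ ?_)
  · simp only [coe_filter, mem_product, mem_Icc, Set.mem_setOf_eq] at hp
    rw [mem_coe, Nat.mem_divisors]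
    exact ⟨⟨p.2, hp.2.symm⟩, hu⟩
  · simp only [coe_filter, mem_product, mem_Icc, Set.mem_setOf_eq] at hp hp'
    have h1 : p.1 = p'.1 := h
    have hp1 : 0 < p.1 := hp.1.1.1
    have h2 : p.2 = p'.2 := by
      have e : p.1 * p.2 = p.1 * p'.2 := by rw [hp.2, ← hp'.2, h1]
      exact Nat.eq_of_mul_eq_mul_left hp1 e
    exact Prod.ext h1 h2

/-- **Cauchy–Schwarz along the divisors**: `‖Σ_{x≤X, y≤Y, xy=u} f(x)g(y)‖² ≤ τ(u) · Σ_{x≤X, y≤Y, xy=u} ‖f x‖²‖g y‖²`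
(`u ≥ 1`). [folklore] -/
theorem norm_sq_convolution_le (X Y : ℕ) (f g : ℕ → ℂ) {u : ℕ} (hu : u ≠ 0) :
    ‖∑ p ∈ (Icc 1 X ×ˢ Icc 1 Y).filter (fun p : ℕ × ℕ ↦ p.1 * p.2 = u), f p.1 * g p.2‖ ^ 2 ≤
      (#u.divisors : ℝ) *
        ∑ p ∈ (Icc 1 X ×ˢ Icc 1 Y).filter (fun p : ℕ × ℕ ↦ p.1 * p.2 = u), ‖f p.1‖ ^ 2 * ‖g p.2‖ ^ 2 := by
  set S := (Icc 1 X ×ˢ Icc 1 Y).filter (fun p : ℕ × ℕ ↦ p.1 * p.2 = u) with hS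
  have h1 : ‖∑ p ∈ S, f p.1 * g p.2‖ ≤ ∑ p ∈ S, ‖f p.1‖ * ‖g p.2‖ :=
    (norm_sum_le _ _).trans (le_of_eq (Finset.sum_congr rfl fun p _ ↦ norm_mul _ _))
  have h0 : 0 ≤ ∑ p ∈ S, ‖f p.1‖ * ‖g p.2‖ := Finset.sum_nonneg fun p _ ↦ by positivity
  -- Cauchy–Schwarz with the constant sequence `1`
  have hCS := Finset.sum_mul_sq_le_sq_mul_sq S (fun _ ↦ (1 : ℝ)) (fun p ↦ ‖f p.1‖ * ‖g p.2‖)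
  simp only [one_pow, Finset.sum_const, nsmul_eq_mul, mul_one, one_mul] at hCS
  calc ‖∑ p ∈ S, f p.1 * g p.2‖ ^ 2 ≤ (∑ p ∈ S, ‖f p.1‖ * ‖g p.2‖) ^ 2 :=
        pow_le_pow_left₀ (norm_nonneg _) h1 2
    _ ≤ (#S : ℝ) * ∑ p ∈ S, (‖f p.1‖ * ‖g p.2‖) ^ 2 := hCS
    _ ≤ (#u.divisors : ℝ) * ∑ p ∈ S, (‖f p.1‖ * ‖g p.2‖) ^ 2 := by
        gcongr
        · exact Finset.sum_nonneg fun p _ ↦ sq_nonneg _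
        · exact_mod_cast card_filter_mul_eq_le_card_divisors X Y hu
    _ = (#u.divisors : ℝ) * ∑ p ∈ S, ‖f p.1‖ ^ 2 * ‖g p.2‖ ^ 2 := by
        congr 1
        exact Finset.sum_congr rfl fun p _ ↦ by ring

/-- Fibrewise decomposition of the product box along `u = xy`:
`Σ_{u ≤ XY} Σ_{x≤X, y≤Y, xy=u} h(x,y) = Σ_{x ≤ X} Σ_{y ≤ Y} h(x,y)`. [folklore] -/
theorem sum_Icc_sum_filter_mul_eq (X Y : ℕ) (h : ℕ × ℕ → ℝ) :
    ∑ u ∈ Icc 1 (X * Y), ∑ p ∈ (Icc 1 X ×ˢ Icc 1 Y).filter (fun p : ℕ × ℕ ↦ p.1 * p.2 = u), h p =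
      ∑ p ∈ Icc 1 X ×ˢ Icc 1 Y, h p := by
  rw [← Finset.sum_fiberwise_of_maps_to (g := fun p : ℕ × ℕ ↦ p.1 * p.2) (t := Icc 1 (X * Y))]
  intro p hp
  simp only [mem_product, mem_Icc] at hp
  rw [mem_Icc]
  exact ⟨Nat.mul_pos hp.1.1 hp.2.1, Nat.mul_le_mul hp.1.2 hp.2.2⟩

/-- **The `ℓ²` norm of a Dirichlet convolution on a box**: if `τ(u) ≤ D` for `1 ≤ u ≤ XY`, then
`Σ_{u ≤ XY} ‖Σ_{x≤X, y≤Y, xy=u} f(x)g(y)‖² ≤ D · (Σ_{x≤X} ‖f x‖²)(Σ_{y≤Y} ‖g y‖²)`. [folklore] -/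
theorem norm_sq_convolution_sum_le (X Y : ℕ) (f g : ℕ → ℂ) {D : ℝ}
    (hD : ∀ u ∈ Icc 1 (X * Y), (#u.divisors : ℝ) ≤ D) :
    ∑ u ∈ Icc 1 (X * Y), ‖∑ p ∈ (Icc 1 X ×ˢ Icc 1 Y).filter (fun p : ℕ × ℕ ↦ p.1 * p.2 = u), f p.1 * g p.2‖ ^ 2 ≤
      D * ((∑ x ∈ Icc 1 X, ‖f x‖ ^ 2) * (∑ y ∈ Icc 1 Y, ‖g y‖ ^ 2)) := by
  have hD0 : ∀ u ∈ Icc 1 (X * Y), 0 ≤ D := fun u hu ↦ le_trans (Nat.cast_nonneg _) (hD u hu)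
  calc ∑ u ∈ Icc 1 (X * Y), ‖∑ p ∈ (Icc 1 X ×ˢ Icc 1 Y).filter (fun p : ℕ × ℕ ↦ p.1 * p.2 = u), f p.1 * g p.2‖ ^ 2
      ≤ ∑ u ∈ Icc 1 (X * Y), D *
          ∑ p ∈ (Icc 1 X ×ˢ Icc 1 Y).filter (fun p : ℕ × ℕ ↦ p.1 * p.2 = u), ‖f p.1‖ ^ 2 * ‖g p.2‖ ^ 2 := by
        refine Finset.sum_le_sum fun u hu ↦ ?_
        have hu0 : u ≠ 0 := by have := (mem_Icc.mp hu).1; omega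
        refine (norm_sq_convolution_le X Y f g hu0).trans ?_
        exact mul_le_mul_of_nonneg_right (hD u hu) (Finset.sum_nonneg fun p _ ↦ by positivity)
    _ = D * ∑ p ∈ Icc 1 X ×ˢ Icc 1 Y, ‖f p.1‖ ^ 2 * ‖g p.2‖ ^ 2 := by
        rw [← Finset.mul_sum, sum_Icc_sum_filter_mul_eq]
    _ = D * ((∑ x ∈ Icc 1 X, ‖f x‖ ^ 2) * (∑ y ∈ Icc 1 Y, ‖g y‖ ^ 2)) := by
        rw [Finset.sum_product, Finset.sum_mul_sum]

/-- **Square-root form**: `‖f ∗ g‖₂ ≤ √D · ‖f‖₂ · ‖g‖₂` on the box (`τ ≤ D` on `[1, XY]`, `D ≥ 0`). [folklore] -/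
theorem sqrt_norm_sq_convolution_sum_le (X Y : ℕ) (f g : ℕ → ℂ) {D : ℝ} (hD0 : 0 ≤ D)
    (hD : ∀ u ∈ Icc 1 (X * Y), (#u.divisors : ℝ) ≤ D) :
    Real.sqrt (∑ u ∈ Icc 1 (X * Y),
        ‖∑ p ∈ (Icc 1 X ×ˢ Icc 1 Y).filter (fun p : ℕ × ℕ ↦ p.1 * p.2 = u), f p.1 * g p.2‖ ^ 2) ≤
      Real.sqrt D * Real.sqrt (∑ x ∈ Icc 1 X, ‖f x‖ ^ 2) * Real.sqrt (∑ y ∈ Icc 1 Y, ‖g y‖ ^ 2) := by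
  have h := norm_sq_convolution_sum_le X Y f g hD
  have hf0 : 0 ≤ ∑ x ∈ Icc 1 X, ‖f x‖ ^ 2 := Finset.sum_nonneg fun _ _ ↦ sq_nonneg _
  rw [← Real.sqrt_mul hD0, ← Real.sqrt_mul (mul_nonneg hD0 hf0), ← mul_assoc] at *
  rw [mul_assoc] 
  exact Real.sqrt_le_sqrt (by rw [mul_assoc] at h; exact h)

/-! ## Appendix (same seat, same day): general two-variable summands

In the balanced regrouping the AFE-side coefficient is `β_v = Σ_{n₁'n₂' = v} h(n₁', n₂')` with a summand
`h(n₁', n₂') = w_{ij}(d₁n₁', d₂n₂')·(√(n₁'n₂'))^{2k+1}` that is NOT a product `f(n₁')g(n₂')` (the two-order AFE weight is a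
function of `n₁n₂` and of `log n₁`, `log n₂`); no Mellin separation is needed, because only the VALUE of the Kloosterman sum
has to depend on `(u, v)` alone (`…LayersKloostermanProduct`), not the weight.  The Cauchy–Schwarz-along-divisors bound holds
verbatim for an arbitrary two-variable summand `h`. -/

/-- **Cauchy–Schwarz along the divisors, general summand**: `‖Σ_{x≤X, y≤Y, xy=u} h(x,y)‖² ≤ τ(u)·Σ_{x≤X, y≤Y, xy=u} ‖h(x,y)‖²`
(`u ≥ 1`). [folklore] -/
theorem norm_sq_fiber_sum_le (X Y : ℕ) (h : ℕ × ℕ → ℂ) {u : ℕ} (hu : u ≠ 0) :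
    ‖∑ p ∈ (Icc 1 X ×ˢ Icc 1 Y).filter (fun p : ℕ × ℕ ↦ p.1 * p.2 = u), h p‖ ^ 2 ≤
      (#u.divisors : ℝ) * ∑ p ∈ (Icc 1 X ×ˢ Icc 1 Y).filter (fun p : ℕ × ℕ ↦ p.1 * p.2 = u), ‖h p‖ ^ 2 := by
  set S := (Icc 1 X ×ˢ Icc 1 Y).filter (fun p : ℕ × ℕ ↦ p.1 * p.2 = u) with hS
  have h1 : ‖∑ p ∈ S, h p‖ ≤ ∑ p ∈ S, ‖h p‖ := norm_sum_le _ _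
  have hCS := Finset.sum_mul_sq_le_sq_mul_sq S (fun _ ↦ (1 : ℝ)) (fun p ↦ ‖h p‖)
  simp only [one_pow, Finset.sum_const, nsmul_eq_mul, mul_one, one_mul] at hCS
  calc ‖∑ p ∈ S, h p‖ ^ 2 ≤ (∑ p ∈ S, ‖h p‖) ^ 2 := pow_le_pow_left₀ (norm_nonneg _) h1 2
    _ ≤ (#S : ℝ) * ∑ p ∈ S, ‖h p‖ ^ 2 := hCS
    _ ≤ (#u.divisors : ℝ) * ∑ p ∈ S, ‖h p‖ ^ 2 := by
        gcongr
        · exact Finset.sum_nonneg fun p _ ↦ sq_nonneg _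
        · exact_mod_cast card_filter_mul_eq_le_card_divisors X Y hu

/-- **The `ℓ²` norm of product-indexed coefficients with a general summand**: if `τ(u) ≤ D` on `[1, XY]`, then
`Σ_{u ≤ XY} ‖Σ_{x≤X, y≤Y, xy=u} h(x,y)‖² ≤ D · Σ_{x≤X} Σ_{y≤Y} ‖h(x,y)‖²`. [folklore] -/
theorem norm_sq_fiber_sum_sum_le (X Y : ℕ) (h : ℕ × ℕ → ℂ) {D : ℝ}
    (hD : ∀ u ∈ Icc 1 (X * Y), (#u.divisors : ℝ) ≤ D) :
    ∑ u ∈ Icc 1 (X * Y), ‖∑ p ∈ (Icc 1 X ×ˢ Icc 1 Y).filter (fun p : ℕ × ℕ ↦ p.1 * p.2 = u), h p‖ ^ 2 ≤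
      D * ∑ p ∈ Icc 1 X ×ˢ Icc 1 Y, ‖h p‖ ^ 2 := by
  calc ∑ u ∈ Icc 1 (X * Y), ‖∑ p ∈ (Icc 1 X ×ˢ Icc 1 Y).filter (fun p : ℕ × ℕ ↦ p.1 * p.2 = u), h p‖ ^ 2
      ≤ ∑ u ∈ Icc 1 (X * Y), D * ∑ p ∈ (Icc 1 X ×ˢ Icc 1 Y).filter (fun p : ℕ × ℕ ↦ p.1 * p.2 = u), ‖h p‖ ^ 2 := by
        refine Finset.sum_le_sum fun u hu ↦ ?_
        have hu0 : u ≠ 0 := by have := (mem_Icc.mp hu).1; omega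
        refine (norm_sq_fiber_sum_le X Y h hu0).trans ?_
        exact mul_le_mul_of_nonneg_right (hD u hu) (Finset.sum_nonneg fun p _ ↦ sq_nonneg _)
    _ = D * ∑ p ∈ Icc 1 X ×ˢ Icc 1 Y, ‖h p‖ ^ 2 := by
        rw [← Finset.mul_sum, sum_Icc_sum_filter_mul_eq]

/-- **Every product `xy` (`x ≤ X`, `y ≤ Y`) lies in `[1, XY]`**, so the fibrewise sum over `u ≤ XY` regroups the FULL double
sum: `Σ_{x≤X} Σ_{y≤Y} h(x,y)·K(xy) = Σ_{u≤XY} (Σ_{xy=u} h(x,y))·K(u)` — the regrouping of a layer's term-sum into a form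
indexed by the product variable. [folklore] -/
theorem sum_sum_mul_eq_sum_fiber (X Y : ℕ) (h : ℕ × ℕ → ℂ) (K : ℕ → ℂ) :
    ∑ x ∈ Icc 1 X, ∑ y ∈ Icc 1 Y, h (x, y) * K (x * y) =
      ∑ u ∈ Icc 1 (X * Y), (∑ p ∈ (Icc 1 X ×ˢ Icc 1 Y).filter (fun p : ℕ × ℕ ↦ p.1 * p.2 = u), h p) * K u := by
  rw [← Finset.sum_product (s := Icc 1 X) (t := Icc 1 Y) (f := fun p : ℕ × ℕ ↦ h (p.1, p.2) * K (p.1 * p.2))]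
  rw [← Finset.sum_fiberwise_of_maps_to (g := fun p : ℕ × ℕ ↦ p.1 * p.2) (t := Icc 1 (X * Y)) (fun p hp ↦ by
    simp only [mem_product, mem_Icc] at hp
    rw [mem_Icc]
    exact ⟨Nat.mul_pos hp.1.1 hp.2.1, Nat.mul_le_mul hp.1.2 hp.2.2⟩)]
  refine Finset.sum_congr rfl fun u _ ↦ ?_
  rw [Finset.sum_mul]
  refine Finset.sum_congr rfl fun p hp ↦ ?_
  rw [(Finset.mem_filter.mp hp).2]

end Summit.Parity.GeneralizedHardyLittlewood.Theorems.MomentsBeyondDiagonal.Layers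

end
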